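import Literature.IUT.HodgeTheaters.PuncturedEllipticCoveringsCusps
import Literature.IUT.HodgeTheaters.InitialThetaDataGoodLocalFrobenioid
import Literature.IUT.HodgeTheaters.InitialThetaDataLocalPuncturedData
import Literature.IUT.HodgeTheaters.PiAvatarNegCompatGood
import HarnessLib

/-!
# [IUTchI] Definition 3.1 (f): `Π_{X̲→_K} ⊆ Π_{C̲→_K} ⊆ Π_{C_F}` are OPEN — the hypothesis `hX` of Example 3.3 at the
# datum discharged BY NAME from the §1 openness clause (`PuncturedEllipticData.ArrowOpenClaims`)

S. Mochizuki, *Inter-universal Teichmüller theory I*, §3, Def. 3.1 (f) (kurims manuscript, May 2020, p. 63)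
[claim: Mochizuki2012, status: disputed]: "the data `(X_K, C̲_K, ε̲)` determines, up to `K`-isomorphism [cf.
Rmk 1.2.1], a finite étale covering `C̲→_K → C̲_K` of degree `l` … and OPEN subgroups `Π_{X̲→_K} ⊆ Π_{C̲→_K} ⊆
Π_{C_F}`. If `v ∈ V̲^good`, then we shall write `Π_v := Π_{X̲→_v}`"; §1 p. 38: the arrows of the cartesian
diagram `X̲→ → X̲`, `C̲→ → C̲` are "open immersions of profinite groups".

PROOF-ONLY companion (theorems only; no definitions, no instances) of this seat's `InitialThetaDataLocalGroups*`,
`InitialThetaDataGoodLocalFrobenioid`, `InitialThetaDataLocalPuncturedData` (abc-iut-L5-t2) over abc-iut-L5-t1's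
post-freeze companion `PuncturedEllipticCoveringsCusps.lean` (`PuncturedEllipticData.ArrowOpenClaims`, the printed
openness clause of §1 p. 38 for the `K`-level datum `D.geom.pe`; GAP-LEDGER G-L5t2g4-1 answer). For
`D : InitialThetaData F K Fbar E l P` (the REAL Def. 3.1):
* `isOpen_PiXarrow_of_arrowOpenClaims` / `isOpen_PiCarrow_of_arrowOpenClaims` — `Π_{X̲→_K}`, `Π_{C̲→_K}` are open in
  `Π_{C_F}`: images of the open `Π_{X̲→}`, `Π_{C̲→} ⊆ Π_{C_K}` of §1 under the OPEN immersion `Π_{C_K} ↪ Π_{C_F}`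
  (`isOpenEmbedding_embK`, Def. 3.1 (d)); this IS the hypothesis `hX` of `goodLocalFrobenioidOfEmb` /
  `goodLocalFrobenioid` / `goodLocalFrobenioidAt` (Ex. 3.3 (i)(ii) AT THE DATUM), so those now take the datum `D`, the
  embedding, and the §1 claims BY NAME — `goodLocalFrobenioidOfEmb_of_arrowOpenClaims_bases` records the closed term;
* `isOpenMap_augLoc_PiXarrow_of_arrowOpenClaims` / `…PiCarrow…` — `Π_v̲ := Π_{X̲→_v̲} ↠ G_v̲` and `Π_{C̲→_v̲} ↠ G_v̲` are
  OPEN surjections (Def. 3.1 (e) "natural outer surjections onto the decomposition group");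
* `isClosed_PiXarrow_…`, `compactSpace_PiLoc_PiXarrow_…` — `Π_v̲` is a closed subgroup of `Π_{C_F} × Gal(Ω/k)`, hence
  PROFINITE (compact) for `Ω/k` Galois;
* unconditional order facts `PiXarrow_le_PiCK`, `PiXarrow_le_PiCund`, `PiXarrow_le_PiXK` (next to abc-iut-L5-t4's
  `PiXarrow_le_PiXund` / `PiCarrow_le_PiCund` / `PiXarrow_le_PiCarrow`, imported), whence `Π_v̲ ⊆ Π_{X̲_v̲} ⊆ Π_{C_v̲}`
  and `Π_v̲ ⊆ Π_{C̲→_v̲} ⊆ Π_{C̲_v̲}` (`PiLoc_PiXarrow_le_…`), and the section clause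
  `Π_{X̲→_K} ∩ Δ_C = embK(jKer)` from the frozen `ArrowCoveringClaims.piXarrow_inf_delta` BY NAME
  (`PiXarrow_inf_deltaC_of_arrowCoveringClaims`; the inclusion `⊇` unconditionally).
Nothing of the series is asserted; the §1 claims enter as hypotheses `h : D.geom.pe.ArrowOpenClaims` /
`hA : D.geom.pe.ArrowCoveringClaims` (printed claims, typed by abc-iut-L5-t1, not facts of the tree); no side taken.
-/

noncomputable section

namespace Literature.IUT.HodgeTheaters

open Topology

universe u v w w'

namespace InitialThetaData

/-! ### Def. 3.1 (f): `Π_{X̲→_K} ⊆ Π_{C̲→_K} ⊆ Π_{C_F}` are open -/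

section Open

variable {F : Type u} {K : Type v} {Fbar : Type w} [Field F] [NumberField F] [Field K] [NumberField K]
  [Algebra F K] [Field Fbar] [Algebra F Fbar] [Algebra K Fbar]
  {E : WeierstrassCurve F} [E.IsElliptic] {l : ℕ} {Pb : BadPlacePredicates K}
  (D : InitialThetaData F K Fbar E l Pb)

/-- **Def. 3.1 (f): `Π_{X̲→_K} ⊆ Π_{C_F}` is OPEN**, given the printed openness clause of §1 p. 38 for the `K`-datum
(`ArrowOpenClaims.isOpen_piXarrow`: `Π_{X̲→} ⊆ Π_{C_K}` open): the open immersion `Π_{C_K} ↪ Π_{C_F}` (Def. 3.1 (d),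
`isOpenEmbedding_embK`) maps it onto an open subgroup. This is the hypothesis `hX` of Ex. 3.3 at the datum.
[claim: Mochizuki2012, status: disputed] -/
theorem isOpen_PiXarrow_of_arrowOpenClaims [IsScalarTower F K Fbar] (h : D.geom.pe.ArrowOpenClaims) :
    IsOpen (D.PiXarrow : Set D.PiC) := by
  change IsOpen ((D.geom.pe.piXarrow.map D.geom.embK : Subgroup D.PiC) : Set D.PiC)
  rw [Subgroup.coe_map]
  exact D.isOpenEmbedding_embK.isOpenMap _ h.isOpen_piXarrow

/-- **Def. 3.1 (f): `Π_{C̲→_K} ⊆ Π_{C_F}` is OPEN**, given the printed openness clause of §1 p. 38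
(`ArrowOpenClaims.isOpen_piCarrow`). [claim: Mochizuki2012, status: disputed] -/
theorem isOpen_PiCarrow_of_arrowOpenClaims [IsScalarTower F K Fbar] (h : D.geom.pe.ArrowOpenClaims) :
    IsOpen (D.PiCarrow : Set D.PiC) := by
  change IsOpen ((D.geom.pe.piCarrow.map D.geom.embK : Subgroup D.PiC) : Set D.PiC)
  rw [Subgroup.coe_map]
  exact D.isOpenEmbedding_embK.isOpenMap _ h.isOpen_piCarrow

/-- `Π_{X̲→_K} ⊆ Π_{C_F}` is CLOSED (an open subgroup of a topological group is closed), given the openness clause.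
[claim: Mochizuki2012, status: disputed] -/
theorem isClosed_PiXarrow_of_arrowOpenClaims [IsScalarTower F K Fbar] (h : D.geom.pe.ArrowOpenClaims) :
    IsClosed (D.PiXarrow : Set D.PiC) :=
  D.PiXarrow.isClosed_of_isOpen (D.isOpen_PiXarrow_of_arrowOpenClaims h)

/-- `Π_{C̲→_K} ⊆ Π_{C_F}` is CLOSED, given the openness clause. [claim: Mochizuki2012, status: disputed] -/
theorem isClosed_PiCarrow_of_arrowOpenClaims [IsScalarTower F K Fbar] (h : D.geom.pe.ArrowOpenClaims) :
    IsClosed (D.PiCarrow : Set D.PiC) :=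
  D.PiCarrow.isClosed_of_isOpen (D.isOpen_PiCarrow_of_arrowOpenClaims h)

/-- `Π_{X̲→_K} ⊆ Π_{C_K}` (the image of the embedding `Π_{C_K} ↪ Π_{C_F}`). [claim: Mochizuki2012, status: disputed] -/
theorem PiXarrow_le_PiCK : D.PiXarrow ≤ D.PiCK := Subgroup.map_le_range _ _

/-- `Π_{C̲→_K} ⊆ Π_{C_K}`. [claim: Mochizuki2012, status: disputed] -/
theorem PiCarrow_le_PiCK : D.PiCarrow ≤ D.PiCK := Subgroup.map_le_range _ _

/-- `Π_{X̲→_K} ⊆ Π_{C̲_K}` (with abc-iut-L5-t4's `PiXarrow_le_PiXund` — `Π_{X̲→_K} ⊆ Π_{X̲_K}`, Def. 3.1 (f) "`X̲→_K`,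
which may also be obtained as `C̲→_K ×_{C̲_K} X̲_K`" — and `PiCarrow_le_PiCund`, `PiXarrow_le_PiCarrow` of
`PiAvatarNegCompatGood` / `PiAvatarLocalInvolution`, imported, not restated). [claim: Mochizuki2012, status: disputed] -/
theorem PiXarrow_le_PiCund : D.PiXarrow ≤ D.PiCund := D.PiXarrow_le_PiXund.trans D.PiXund_le_PiCund

/-- `Π_{X̲→_K} ⊆ Π_{X_K}`. [claim: Mochizuki2012, status: disputed] -/
theorem PiXarrow_le_PiXK : D.PiXarrow ≤ D.PiXK := D.PiXarrow_le_PiXund.trans D.PiXund_le_PiXK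

/-- `Δ_{X̲→} := Π_{X̲→_K} ∩ Δ_C ⊇ (the image of) jKer` — the unconditional half of the section clause (abc-iut-L5-t1's
`jKer_le_piXarrow_inf_delta`, transported: `embK y ∈ Δ_C ↔ y ∈ Δ_{C_K}`). [claim: Mochizuki2012, status: disputed] -/
theorem map_jKer_le_PiXarrow_inf_deltaC : D.geom.pe.jKer.map D.geom.embK ≤ D.PiXarrow ⊓ D.DeltaC := by
  rintro _ ⟨y, hy, rfl⟩
  obtain ⟨hy1, hy2⟩ := Subgroup.mem_inf.mp (D.geom.pe.jKer_le_piXarrow_inf_delta hy)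
  exact Subgroup.mem_inf.mpr ⟨⟨y, hy1, rfl⟩, (D.embK_mem_deltaC_iff y).mpr hy2⟩

/-- **Def. 3.1 (f): `Δ_{X̲→} := Π_{X̲→_K} ∩ Δ_C` is (the image of) `jKer`** — the section clause
`Π_{X̲→} ∩ Δ_{C_K} = jKer` of the frozen §1 claims (`ArrowCoveringClaims.piXarrow_inf_delta`) transported along
`Π_{C_K} ↪ Π_{C_F}` (`embK y ∈ Δ_C ↔ y ∈ Δ_{C_K}`). [claim: Mochizuki2012, status: disputed] -/
theorem PiXarrow_inf_deltaC_of_arrowCoveringClaims (hA : D.geom.pe.ArrowCoveringClaims) :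
    D.PiXarrow ⊓ D.DeltaC = D.geom.pe.jKer.map D.geom.embK := by
  ext x
  constructor
  · intro hx
    obtain ⟨hx1, hx2⟩ := Subgroup.mem_inf.mp hx
    obtain ⟨y, hy, rfl⟩ := hx1
    have hyΔ : y ∈ D.geom.pe.DeltaC := (D.embK_mem_deltaC_iff y).mp hx2
    have : y ∈ D.geom.pe.piXarrow ⊓ D.geom.pe.DeltaC := Subgroup.mem_inf.mpr ⟨hy, hyΔ⟩
    rw [hA.piXarrow_inf_delta] at this
    exact ⟨y, this, rfl⟩
  · rintro ⟨y, hy, rfl⟩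
    have : y ∈ D.geom.pe.piXarrow ⊓ D.geom.pe.DeltaC := by rw [hA.piXarrow_inf_delta]; exact hy
    obtain ⟨hy1, hy2⟩ := Subgroup.mem_inf.mp this
    exact Subgroup.mem_inf.mpr ⟨⟨y, hy1, rfl⟩, (D.embK_mem_deltaC_iff y).mpr hy2⟩

end Open

/-! ### Def. 3.1 (e)/(f): `Π_v̲ := Π_{X̲→_v̲} ↠ G_v̲` is an OPEN surjection of PROFINITE groups -/

section BaseChange

variable {F : Type u} {K : Type v} {Fbar : Type w} [Field F] [NumberField F] [Field K] [NumberField K]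
  [Algebra F K] [Field Fbar] [Algebra F Fbar] [Algebra K Fbar] [IsScalarTower F K Fbar] [Normal K Fbar]
  {E : WeierstrassCurve F} [E.IsElliptic] {l : ℕ} {Pb : BadPlacePredicates K}
  (D : InitialThetaData F K Fbar E l Pb)
  {Ω : Type w'} [Field Ω] [Algebra K Ω]
  (k : Type w') [Field k] [Algebra K k] [Algebra k Ω] [IsScalarTower K k Ω] (ι : Fbar →ₐ[K] Ω)

/-- **`Π_v̲ := Π_{X̲→_v̲} ↠ Gal(Ω/k)` is OPEN** (`k = K_v̲`, Def. 3.1 (e)(f)), the hypothesis `hX` of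
`isOpenMap_augLoc` discharged by the §1 openness clause. [claim: Mochizuki2012, status: disputed] -/
theorem isOpenMap_augLoc_PiXarrow_of_arrowOpenClaims (h : D.geom.pe.ArrowOpenClaims) :
    IsOpenMap (D.augLoc D.PiXarrow (localToGF F k ι)) :=
  D.isOpenMap_augLoc D.PiXarrow (localToGF F k ι) (D.isOpen_PiXarrow_of_arrowOpenClaims h)
    (continuous_localToGF F k ι)

/-- **`Π_{C̲→_v̲} ↠ Gal(Ω/k)` is OPEN**, given the §1 openness clause. [claim: Mochizuki2012, status: disputed] -/
theorem isOpenMap_augLoc_PiCarrow_of_arrowOpenClaims (h : D.geom.pe.ArrowOpenClaims) :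
    IsOpenMap (D.augLoc D.PiCarrow (localToGF F k ι)) :=
  D.isOpenMap_augLoc D.PiCarrow (localToGF F k ι) (D.isOpen_PiCarrow_of_arrowOpenClaims h)
    (continuous_localToGF F k ι)

/-- `Π_v̲ ↠ Gal(Ω/k)` is SURJECTIVE (unconditional; restated next to the openness for the consumer).
[claim: Mochizuki2012, status: disputed] -/
theorem augLoc_PiXarrow_localToGF_surjective : Function.Surjective (D.augLoc D.PiXarrow (localToGF F k ι)) :=
  D.augLoc_surjective D.PiXarrow (localToGF F k ι)
    ((decompositionSubgroupGF_le F k ι).trans D.galoisSubgroupOf_le_map_PiXarrow)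

/-- `Π_{C̲→_v̲} ↠ Gal(Ω/k)` is SURJECTIVE (unconditional: `Π_{X̲→_K} ⊆ Π_{C̲→_K}`). [claim: Mochizuki2012, status: disputed] -/
theorem augLoc_PiCarrow_localToGF_surjective : Function.Surjective (D.augLoc D.PiCarrow (localToGF F k ι)) :=
  D.augLoc_surjective D.PiCarrow (localToGF F k ι)
    ((decompositionSubgroupGF_le F k ι).trans
      (D.galoisSubgroupOf_le_map_PiXarrow.trans (Subgroup.map_mono D.PiXarrow_le_PiCarrow)))

/-- `Π_v̲ ⊆ Π_{C_v̲}` and `Π_{C̲→_v̲} ⊆ Π_{C_v̲}` inside `Π_{C_F} × Gal(Ω/k)` (Def. 3.1 (f) "`⊆ Π_{C_v}`").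
[claim: Mochizuki2012, status: disputed] -/
theorem PiLoc_PiXarrow_le_PiLoc_PiCK :
    D.PiLoc D.PiXarrow (localToGF F k ι) ≤ D.PiLoc D.PiCK (localToGF F k ι) ∧
      D.PiLoc D.PiCarrow (localToGF F k ι) ≤ D.PiLoc D.PiCK (localToGF F k ι) :=
  ⟨D.PiLoc_mono _ D.PiXarrow_le_PiCK, D.PiLoc_mono _ D.PiCarrow_le_PiCK⟩

/-- `Π_v̲ ⊆ Π_{C̲→_v̲}` (Def. 3.1 (f) "`Π_{X̲→_v} ⊆ Π_{C̲→_v}`"). [claim: Mochizuki2012, status: disputed] -/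
theorem PiLoc_PiXarrow_le_PiLoc_PiCarrow :
    D.PiLoc D.PiXarrow (localToGF F k ι) ≤ D.PiLoc D.PiCarrow (localToGF F k ι) :=
  D.PiLoc_mono _ D.PiXarrow_le_PiCarrow

/-- `Π_v̲ ⊆ Π_{X̲_v̲}` (`X̲→_v → X̲_v`, Def. 3.1 (e)/(f)). [claim: Mochizuki2012, status: disputed] -/
theorem PiLoc_PiXarrow_le_PiLoc_PiXund :
    D.PiLoc D.PiXarrow (localToGF F k ι) ≤ D.PiLoc D.PiXund (localToGF F k ι) :=
  D.PiLoc_mono _ D.PiXarrow_le_PiXund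

/-- `Π_{C̲→_v̲} ⊆ Π_{C̲_v̲}` (`C̲→_v → C̲_v`, Def. 3.1 (e)/(f)). [claim: Mochizuki2012, status: disputed] -/
theorem PiLoc_PiCarrow_le_PiLoc_PiCund :
    D.PiLoc D.PiCarrow (localToGF F k ι) ≤ D.PiLoc D.PiCund (localToGF F k ι) :=
  D.PiLoc_mono _ D.PiCarrow_le_PiCund

variable [Algebra.IsIntegral F Fbar]

/-- `Π_v̲ ⊆ Π_{C_F} × Gal(Ω/k)` is CLOSED, given the §1 openness clause (`Π_{X̲→_K}` open hence closed; `G_F`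
Hausdorff). [claim: Mochizuki2012, status: disputed] -/
theorem isClosed_PiLoc_PiXarrow_of_arrowOpenClaims (h : D.geom.pe.ArrowOpenClaims) :
    IsClosed (D.PiLoc D.PiXarrow (localToGF F k ι) : Set (D.PiC × (Ω ≃ₐ[k] Ω))) :=
  D.isClosed_PiLoc_of_isClosed D.PiXarrow (localToGF F k ι) (D.isClosed_PiXarrow_of_arrowOpenClaims h)
    (continuous_localToGF F k ι)

/-- **`Π_v̲ := Π_{X̲→_v̲}` is PROFINITE** (compact; it is a closed subgroup of the profinite `Π_{C_F} × Gal(Ω/k)` for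
`Ω/k` Galois), given the §1 openness clause. [claim: Mochizuki2012, status: disputed] -/
theorem compactSpace_PiLoc_PiXarrow_of_arrowOpenClaims [IsGalois k Ω] (h : D.geom.pe.ArrowOpenClaims) :
    CompactSpace (D.PiLoc D.PiXarrow (localToGF F k ι)) :=
  isCompact_iff_compactSpace.mp (D.isClosed_PiLoc_PiXarrow_of_arrowOpenClaims k ι h).isCompact

/-- `Π_{C̲→_v̲}` is PROFINITE (compact), given the §1 openness clause. [claim: Mochizuki2012, status: disputed] -/
theorem compactSpace_PiLoc_PiCarrow_of_arrowOpenClaims [IsGalois k Ω] (h : D.geom.pe.ArrowOpenClaims) :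
    CompactSpace (D.PiLoc D.PiCarrow (localToGF F k ι)) :=
  isCompact_iff_compactSpace.mp
    (D.isClosed_PiLoc_of_isClosed D.PiCarrow (localToGF F k ι) (D.isClosed_PiCarrow_of_arrowOpenClaims h)
      (continuous_localToGF F k ι)).isCompact

end BaseChange

/-! ### Example 3.3 (i)(ii) AT THE DATUM with `hX` discharged BY NAME -/

section Example33

open Literature.AnabelianGeometry.SemiGraphs

variable {F : Type u} {K : Type v} {Fbar : Type} [Field F] [NumberField F] [Field K] [NumberField K]
  [Algebra F K] [Field Fbar] [Algebra F Fbar] [Algebra K Fbar] [IsScalarTower F K Fbar] [Normal K Fbar]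
  {E : WeierstrassCurve F} [E.IsElliptic] {l : ℕ} {Pb : BadPlacePredicates K}
  (D : InitialThetaData F K Fbar E l Pb) (p : ℕ) [Fact p.Prime]
  (k : Type) [NontriviallyNormedField k] [CompleteSpace k] [IsUltrametricDist k] [NormedAlgebra ℚ_[p] k]
  [FiniteDimensional ℚ_[p] k] [Algebra K k]

/-- **[IUTchI] Example 3.3 (i)–(ii) for the initial Θ-datum `D` at `v̲ ∈ V̲^good ∩ V̲^non` (`K_v̲ = k` complete, finite
over `ℚ_p`), from `D`, an embedding `ι : F̄ → k̄` and the §1 openness clause ALONE**: the closed term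
`D.goodLocalFrobenioidOfEmb p k ι (D.isOpen_PiXarrow_of_arrowOpenClaims h)` has `D_v̲ = 𝓑(Π_v̲)⁰ = CosetCat Π_v̲`,
`D⊢_v̲ = 𝓑(K_v̲)⁰ = CosetCat Gal(k̄/k)`, and `D_v̲ → D⊢_v̲` the push-forward along the (now unconditionally open)
`Π_v̲ ↠ Gal(k̄/k)`. [claim: Mochizuki2012, status: disputed] -/
theorem goodLocalFrobenioidOfEmb_of_arrowOpenClaims_bases (ι : Fbar →ₐ[K] AlgebraicClosure k)
    (h : D.geom.pe.ArrowOpenClaims) :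
    @GoodLocalFrobenioid.Dv p k _ (GaloisValDatum.normVal k)
        (D.goodLocalFrobenioidOfEmb p k ι (D.isOpen_PiXarrow_of_arrowOpenClaims h)) =
        CosetCat (D.PiLoc D.PiXarrow (localToGF F k ι)) ∧
      @GoodLocalFrobenioid.Ddash p k _ (GaloisValDatum.normVal k)
        (D.goodLocalFrobenioidOfEmb p k ι (D.isOpen_PiXarrow_of_arrowOpenClaims h)) =
        CosetCat (AlgebraicClosure k ≃ₐ[k] AlgebraicClosure k) ∧
      @GoodLocalFrobenioid.proj p k _ (GaloisValDatum.normVal k)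
        (D.goodLocalFrobenioidOfEmb p k ι (D.isOpen_PiXarrow_of_arrowOpenClaims h)) =
        CosetCat.push (D.augLoc D.PiXarrow (localToGF F k ι))
          (D.isOpenMap_augLoc_PiXarrow_of_arrowOpenClaims k ι h) :=
  ⟨rfl, rfl, rfl⟩

/-- **[IUTchI] Example 3.3 (i)–(ii) for `D` at `v̲` with `K_v̲ = k`, for the chosen embedding `F̄ → k̄`**, from `D` and
the §1 openness clause alone: the interface `GoodLocalFrobenioid p k` is inhabited by the datum-level construction
`D.goodLocalFrobenioid p k (D.isOpen_PiXarrow_of_arrowOpenClaims h)` (whose `D_v̲` is `CosetCat Π_v̲` for the chosen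
`ι = localEmb`). [claim: Mochizuki2012, status: disputed] -/
theorem nonempty_goodLocalFrobenioid_of_arrowOpenClaims (h : D.geom.pe.ArrowOpenClaims) :
    ∃ G : @GoodLocalFrobenioid.{0} p k _ (GaloisValDatum.normVal k),
      @GoodLocalFrobenioid.Dv p k _ (GaloisValDatum.normVal k) G =
        CosetCat (D.PiLoc D.PiXarrow
          (localToGF F k (localEmb (AlgebraicClosure k) : Fbar →ₐ[K] AlgebraicClosure k))) :=
  ⟨D.goodLocalFrobenioid p k (D.isOpen_PiXarrow_of_arrowOpenClaims h), rfl⟩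

end Example33

end InitialThetaData

end Literature.IUT.HodgeTheaters

end
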